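import Literature.MathematicalPhysics.QuantumLattice.AnisotropicHeisenbergThermalInfraredBound
import Literature.MathematicalPhysics.QuantumLattice.AnisotropicHeisenbergTwoSumRule
import HarnessLib

/-!
# Kennedy–Lieb–Shastry's two-sum-rule programme (6)–(9) for the model (5) at positive
# temperature: the Dyson–Lieb–Simon term `1/(2βE^K_{q-Q})`, finite volume, and Néel order from a
# certificate at fixed `β`

Topic `MathematicalPhysics/QuantumLattice`; the positive-temperature companion of
`AnisotropicHeisenbergTwoSumRule.lean` (ground state), built on the thermal infrared bound
`heisAniso_infraredBound_thermal` of `AnisotropicHeisenbergThermalInfraredBound.lean`. No named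
fact is introduced; everything here is a theorem. Nothing numerical is asserted: the two punctured
Riemann sums `𝓦^K_{t,μ}(L)` (as in the ground state) and the new thermal sum `𝓣^K_{t,μ}(L)` stay
symbolic.

## What is printed

[KLS1988JSP] p. 1020: "(Although we only consider the ground states of these models, the techniques
we use may be combined with the techniques of Dyson et al. for nonzero temperatures to prove the
existence of a phase transition for `1 ≥ r ≥ 0.16`.)"; p. 1023, eqs. (6)–(9): the linear programme
"maximize `I = ∫d³q g_q` subject to (6) `0 ≤ g_q ≤ f^r_q` and (8)
`∫d³q g_q(cos q₁ + cos q₂ + r cos q₃) = -e^r_0/3` … If the maximum of `I` is less than `1/4`, then …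
there must be Néel order". [DLS1978] Thm. 6.1 / Thm. 5.1: at `T > 0` the infrared bound acquires the
additional term `(2βE_p)⁻¹`, whose momentum average is the constant
`C_d = (2π)^{-d}∫ d^dp/E_p` of (4.7)/Thm. 5.1 ([FILS1978] (4.7) for direction-dependent couplings).

## What is proved (finite volume, every `d`, every spin `S = n/2`, every `K > 0`, `β > 0`, even side `2k ≥ 4`)

* the sum rules at `T > 0`: `heisAniso_gibbsStructureFactor_totalSumRule` ((2):
  `Σ_q ĝ_q = |Λ| S(S+1)/3`, on-site Casimir + isotropy (Iᵀ)), `heisAniso_gibbsStructureFactor_dirSumRule`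
  ((3ᵢ), Parseval);
* `heisAnisoThermalRiemannSum K t μ L = L^{-d} Σ_{q ≠ Q} {t + Σᵢμᵢcos qᵢ}₊ / E^K_{q-Q}` — the
  Dyson–Lieb–Simon thermal sum, weighted by the two-sum-rule multiplier;
* `heisAniso_infraredBound_thermal_of_le` — the thermal infrared bound with a common bound `s` on
  the `-εᵢ(β)`: `ĝ_q ≤ 1/(2βE^K_{q-Q}) + (s/2)^{1/2}(E^K_q/E^K_{q-Q})^{1/2}`;
* **`heisAniso_twoSumRule_thermal`** — for every real `t`, `μ` and `s ≥ 0` with `-εᵢ(β) ≤ s`: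
  `t·S(S+1)/3 + Σᵢ μᵢ εᵢ(β) - (s/2)^{1/2} 𝓦^K_{t,μ}(L) - (2β)⁻¹ 𝓣^K_{t,μ}(L) ≤ (t - Σᵢμᵢ)·m_L(β)`,
  `m_L(β) = |Λ|⁻¹ ĝ_Q(β)` (the ground-state inequality `heisAniso_twoSumRule` plus the thermal term);
  `heisAniso_twoSumRule_thermal_sq` — the same with the unconditional a-priori bound `s = S²` of (T);
* the staggered order parameter at `T > 0`: `heisAniso_thermal_neelSum_eq`
  (`|Λ|⁻²Σ_{x,y}(-1)^{x+y}⟨𝐒_x·𝐒_y⟩_β = 3m_L(β)`), `heisAniso_thermal_neelSum_le`;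
* **`heisAniso_thermal_neelOrder_of_certificate`**, **`heisAniso_thermal_neelLRO_of_certificate`** —
  Néel order at a fixed inverse temperature `β` from finitely many eventual bounds
  `𝓦^K_{tⱼ,μⱼ}(2k) ≤ W̄ⱼ`, `𝓣^K_{tⱼ,μⱼ}(2k) ≤ T̄ⱼ` and a real-arithmetic certificate over the
  a-priori region of the unknowns `(εᵢ(β))` cut out by (T) `|εᵢ| ≤ S²` and the Néel energy–entropy
  bound (Nᵀ) `ΣᵢKᵢεᵢ ≤ -(S²/3)ΣᵢKᵢ + log(2S+1)/(3β)` — the form in which certified values of the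
  integrals are consumed (`AnisotropicHeisenbergThermalNeelOrder.lean`).

## References

* [KLS1988JSP] T. Kennedy, E. H. Lieb, B. S. Shastry, J. Stat. Phys. 53 (1988) 1019–1030, p. 1020,
  eqs. (2)–(3), (5)–(9), pp. 1021–1023, 1026.
* [DLS1978] F. J. Dyson, E. H. Lieb, B. Simon, J. Stat. Phys. 18 (1978) 335–383, Thms. 5.1, 6.1, 6.2.
* [FILS1978] J. Fröhlich, R. Israel, E. H. Lieb, B. Simon, Commun. Math. Phys. 62 (1978) 1–34, (4.7).
-/

noncomputable section

open Filter Topology Matrix Finset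
open Literature.MathematicalPhysics.QuantumLattice Literature.MathematicalPhysics.QuantumLattice.SpinOperators
  Literature.Probability.LatticeModels
open scoped ComplexOrder

namespace Literature.MathematicalPhysics.QuantumLattice

variable {d : ℕ}

/-! ### The sum rules (2) and (3ᵢ) for `H_K` at positive temperature -/

section SumRules

variable (L : ℕ) [NeZero L] (n : ℕ) (K : Fin d → ℝ) (β : ℝ)

/-- The on-site value `G¹_β(x,x) = S(S+1)/3` (on-site Casimir `Σ_α(S^α_x)² = S(S+1)`, normalisation
of the Gibbs state and isotropy (Iᵀ)). [cite: KLS1988JSP, eq. (2)] -/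
theorem gibbsSpinCorr_anisoHeis_self (x : TorusSite d L) :
    gibbsSpinCorr β (heisAnisoTorus L n K) 0 x x = (n : ℝ) / 2 * ((n : ℝ) / 2 + 1) / 3 := by
  have hH := heisAnisoTorus_isHermitian L n K
  haveI : Nonempty (TensorIndex (TorusSite d L) (n + 1)) := ⟨fun _ => 0⟩
  have hZ : partitionFn β (heisAnisoTorus L n K) ≠ 0 := (partitionFn_pos β hH).ne'
  have h3 : ∑ α : Fin 3, gibbsSpinCorr β (heisAnisoTorus L n K) α x x =
      (n : ℝ) / 2 * ((n : ℝ) / 2 + 1) := by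
    simp_rw [gibbsSpinCorr]
    rw [← Complex.re_sum, ← map_sum, sum_siteSpin_mul_siteSpin_holds n x, LinearMap.map_smul,
      gibbsState_one β _ hZ, smul_eq_mul, mul_one]
    have : ((n : ℂ) / 2 * ((n : ℂ) / 2 + 1)) = (((n : ℝ) / 2 * ((n : ℝ) / 2 + 1) : ℝ) : ℂ) := by
      push_cast; ring
    rw [this, Complex.ofReal_re]
  rw [Fin.sum_univ_three, gibbsSpinCorr_anisoHeis_eq_zero_comp L n K β 1,
    gibbsSpinCorr_anisoHeis_eq_zero_comp L n K β 2] at h3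
  linarith

/-- **The total sum rule (2) for `H_K` at positive temperature**: `Σ_q ĝ_q(β) = |Λ| S(S+1)/3`.
[cite: KLS1988JSP, eq. (2)] -/
theorem heisAniso_gibbsStructureFactor_totalSumRule :
    ∑ q : TorusSite d L, gibbsStructureFactor β (heisAnisoTorus L n K) 0 q =
      (L : ℝ) ^ d * ((n : ℝ) / 2 * ((n : ℝ) / 2 + 1) / 3) := by
  have hL1 : (L : ℝ) ≠ 0 := by exact_mod_cast NeZero.ne L
  have hL0 : (L : ℝ) ^ d ≠ 0 := pow_ne_zero _ hL1
  have hH := heisAnisoTorus_isHermitian L n K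
  have hcard : (Fintype.card (TorusSite d L) : ℝ) = (L : ℝ) ^ d := by
    rw [Fintype.card_pi, prod_const, ZMod.card, card_univ, Fintype.card_fin]; push_cast; ring
  have h0 : ∀ q : TorusSite d L, Real.cos (torusPhase L q 0) = 1 := by
    intro q; simp [torusPhase]
  have h := sum_structureFactor_mul_cos_torusPhase L (gibbsSpinCorr β (heisAnisoTorus L n K) 0)
    (gibbsSpinCorr_symm β hH 0) (0 : TorusSite d L)
  simp_rw [h0, mul_one, add_zero, gibbsSpinCorr_anisoHeis_self L n K β, sum_const, card_univ,
    nsmul_eq_mul, hcard] at h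
  simp_rw [gibbsStructureFactor]
  rw [← sum_div, h]
  field_simp

/-- **The direction-resolved energy sum rule (3ᵢ) for `H_K` at positive temperature**:
`Σ_q ĝ_q(β) cos qᵢ = |Λ| εᵢ(β)` (Parseval; the tree's `gibbsStructureFactor_dirSumRule`).
[cite: KLS1988JSP, eqs. (3), (8)] -/
theorem heisAniso_gibbsStructureFactor_dirSumRule (i : Fin d) :
    ∑ q : TorusSite d L, gibbsStructureFactor β (heisAnisoTorus L n K) 0 q *
        Real.cos (latticeMomentum L q i) =
      (L : ℝ) ^ d * gibbsDirBondCorr β (heisAnisoTorus L n K) 0 i := by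
  have hL0 : (L : ℝ) ^ d ≠ 0 := by
    have : (L : ℝ) ≠ 0 := by exact_mod_cast NeZero.ne L
    positivity
  have h := gibbsStructureFactor_dirSumRule β (heisAnisoTorus_isHermitian L n K) 0 i
  rw [div_eq_iff hL0] at h
  rw [h, mul_comm]

end SumRules

/-! ### The thermal punctured Riemann sum of Dyson–Lieb–Simon, weighted by the multiplier -/

/-- `E^K_p ≥ 0` for `K ≥ 0`. [cite: KLS1988JSP, eq. (7)] -/
theorem heisAniso_anisoDispersion_nonneg {K : Fin d → ℝ} (hK : ∀ i, 0 ≤ K i) (p : Fin d → ℝ) :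
    0 ≤ NVectorAniso.anisoDispersion K p := by
  rw [NVectorAniso.anisoDispersion]
  exact sum_nonneg fun i _ => mul_nonneg (hK i) (sub_nonneg.2 (Real.cos_le_one _))

/-- **The thermal Riemann sum of the two-sum-rule programme for the model (5)**,
`𝓣^K_{t,μ}(L) = L^{-d} Σ_{q ≠ Q} {κ_{t,μ}(q)}₊ / E^K_{q-Q}` (`κ_{t,μ}(q) = t + Σᵢμᵢcos qᵢ`,
`E^K_q = ΣᵢKᵢ(1 - cos qᵢ)`; junk `0` at `L = 0`): the momentum average of the Dyson–Lieb–Simon term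
`(2βE_p)⁻¹` of the thermal infrared bound against the positive part of the multiplier (for
`(t, μ) = (1, 0)` it is the torus sum `L^{-d}Σ_{p≠0}1/E^K_p` of [FILS1978] (4.7)–(4.10)).
[cite: DLS1978, Thm. 5.1, Thm. 6.1] [cite: KLS1988JSP, eqs. (6)-(9), p. 1020] -/
def heisAnisoThermalRiemannSum (K : Fin d → ℝ) (t : ℝ) (μ : Fin d → ℝ) (L : ℕ) : ℝ :=
  if hL : L = 0 then 0
  else
    haveI : NeZero L := ⟨hL⟩
    (∑ q ∈ (univ : Finset (TorusSite d L)).erase (neelIndex L),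
        max (heisAnisoKernel t μ L q) 0 /
          NVectorAniso.anisoDispersion K (latticeMomentum L (q - neelIndex L))) / (L : ℝ) ^ d

/-- Unfolding `𝓣^K_{t,μ}(L)` on a genuine torus. [cite: DLS1978, Thm. 5.1] -/
theorem heisAnisoThermalRiemannSum_of_neZero (K : Fin d → ℝ) (t : ℝ) (μ : Fin d → ℝ) (L : ℕ)
    [NeZero L] :
    heisAnisoThermalRiemannSum K t μ L =
      (∑ q ∈ (univ : Finset (TorusSite d L)).erase (neelIndex L),
          max (heisAnisoKernel t μ L q) 0 /
            NVectorAniso.anisoDispersion K (latticeMomentum L (q - neelIndex L))) / (L : ℝ) ^ d := by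
  simp [heisAnisoThermalRiemannSum, NeZero.ne L]

/-- `𝓣^K_{t,μ}(L) ≥ 0` for `K ≥ 0`. [cite: DLS1978, Thm. 5.1] -/
theorem heisAnisoThermalRiemannSum_nonneg {K : Fin d → ℝ} (hK : ∀ i, 0 ≤ K i) (t : ℝ)
    (μ : Fin d → ℝ) (L : ℕ) : 0 ≤ heisAnisoThermalRiemannSum K t μ L := by
  rcases Nat.eq_zero_or_pos L with rfl | hL
  · simp [heisAnisoThermalRiemannSum]
  haveI : NeZero L := ⟨hL.ne'⟩
  rw [heisAnisoThermalRiemannSum_of_neZero]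
  refine div_nonneg (sum_nonneg fun q _ => div_nonneg (le_max_right _ _)
    (heisAniso_anisoDispersion_nonneg hK _)) ?_
  positivity

/-! ### The thermal infrared bound with a common bound `s` on `-εᵢ(β)` -/

/-- The thermal direction-resolved infrared bound with every `-εᵢ(β)` replaced by a common upper
bound `s ≥ 0`: `ĝ_q ≤ 1/(2βE^K_{q-Q}) + (s/2)^{1/2} (E^K_q/E^K_{q-Q})^{1/2}` (`q ≠ Q`, `K > 0`;
`-2ΣᵢKᵢ(1 - cos qᵢ)εᵢ ≤ 2sE^K_q`). [cite: KLS1988JSP, eqs. (6)–(7), p. 1026] [cite: DLS1978, Thm. 6.1] -/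
theorem heisAniso_infraredBound_thermal_of_le (n k : ℕ) [NeZero (2 * k)] (hk : 2 ≤ k)
    {K : Fin d → ℝ} (hK : ∀ i, 0 < K i) {β : ℝ} (hβ : 0 < β) {s : ℝ} (hs0 : 0 ≤ s)
    (hs : ∀ i, -gibbsDirBondCorr β (heisAnisoTorus (2 * k) n K) 0 i ≤ s) (q : TorusSite d (2 * k))
    (hq : q ≠ neelIndex (2 * k)) :
    0 ≤ gibbsStructureFactor β (heisAnisoTorus (2 * k) n K) 0 q ∧
      gibbsStructureFactor β (heisAnisoTorus (2 * k) n K) 0 q ≤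
        1 / (2 * β * NVectorAniso.anisoDispersion K (latticeMomentum (2 * k) (q - neelIndex (2 * k)))) +
          Real.sqrt (s / 2) * Real.sqrt (NVectorAniso.anisoDispersion K (latticeMomentum (2 * k) q) /
            NVectorAniso.anisoDispersion K (latticeMomentum (2 * k) (q - neelIndex (2 * k)))) := by
  obtain ⟨h0, hIR⟩ := heisAniso_infraredBound_thermal n k hk hK hβ q hq
  refine ⟨h0, hIR.trans ?_⟩
  set E' : ℝ := NVectorAniso.anisoDispersion K (latticeMomentum (2 * k) (q - neelIndex (2 * k)))
    with hE'_def
  set Eq : ℝ := NVectorAniso.anisoDispersion K (latticeMomentum (2 * k) q) with hEq_def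
  have hE' : 0 < E' := anisoDispersion_latticeMomentum_pos (2 * k) hK (sub_ne_zero.2 hq)
  have hE'0 : E' ≠ 0 := hE'.ne'
  have hEq0 : 0 ≤ Eq := heisAniso_anisoDispersion_nonneg (fun i => (hK i).le) _
  -- the radicand is at most `2 s E^K_q`
  have hrad : -2 * ∑ i : Fin d, K i * (1 - Real.cos (latticeMomentum (2 * k) q i)) *
      gibbsDirBondCorr β (heisAnisoTorus (2 * k) n K) 0 i ≤ 2 * s * Eq := by
    rw [hEq_def, NVectorAniso.anisoDispersion, mul_sum, mul_sum]
    refine sum_le_sum fun i _ => ?_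
    have hi := hs i
    have hw : 0 ≤ K i * (1 - Real.cos (latticeMomentum (2 * k) q i)) :=
      mul_nonneg (hK i).le (sub_nonneg.2 (Real.cos_le_one _))
    nlinarith [mul_nonneg hw (by linarith [hi] :
      (0 : ℝ) ≤ s + gibbsDirBondCorr β (heisAnisoTorus (2 * k) n K) 0 i)]
  have h4 : Real.sqrt 4 = 2 := by
    rw [show (4 : ℝ) = 2 ^ 2 by norm_num, Real.sqrt_sq (by norm_num : (0 : ℝ) ≤ 2)]
  have heq : Real.sqrt (2 * s * Eq / E') = 2 * (Real.sqrt (s / 2) * Real.sqrt (Eq / E')) := by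
    rw [← Real.sqrt_mul (by positivity : 0 ≤ s / 2), ← h4,
      ← Real.sqrt_mul (by norm_num : (0 : ℝ) ≤ 4)]
    congr 1
    field_simp
    ring
  calc 1 / (2 * β * E') + 1 / 2 * Real.sqrt ((-2 * ∑ i : Fin d, K i *
          (1 - Real.cos (latticeMomentum (2 * k) q i)) *
            gibbsDirBondCorr β (heisAnisoTorus (2 * k) n K) 0 i) / E')
      ≤ 1 / (2 * β * E') + 1 / 2 * Real.sqrt (2 * s * Eq / E') :=
        add_le_add le_rfl (mul_le_mul_of_nonneg_left
          (Real.sqrt_le_sqrt (div_le_div_of_nonneg_right hrad hE'.le))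
          (by norm_num : (0 : ℝ) ≤ 1 / 2))
    _ = 1 / (2 * β * E') + Real.sqrt (s / 2) * Real.sqrt (Eq / E') := by rw [heq]; ring

/-- The pointwise step behind the thermal two-sum rule: if `0 ≤ g ≤ b₀ + a·R`, then
`g·κ ≤ a·({κ}₊·R) + b₀·{κ}₊` (for `κ ≤ 0` the left side is `≤ 0` and the right side vanishes).
[cite: KLS1988JSP, eqs. (6)-(9)] -/
theorem heisAniso_thermal_pointwise {g κ b₀ a R : ℝ} (hg : 0 ≤ g) (hA : g ≤ b₀ + a * R) :
    g * κ ≤ a * (max κ 0 * R) + b₀ * max κ 0 := by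
  rcases le_or_gt κ 0 with hκ | hκ
  · rw [max_eq_right hκ, zero_mul, mul_zero, mul_zero, add_zero]
    exact mul_nonpos_of_nonneg_of_nonpos hg hκ
  · rw [max_eq_left hκ.le]
    calc g * κ ≤ (b₀ + a * R) * κ := mul_le_mul_of_nonneg_right hA hκ.le
      _ = a * (κ * R) + b₀ * κ := by ring

/-! ### The two-sum-rule bound at positive temperature, dual form -/

/-- **Kennedy–Lieb–Shastry's programme (6)–(9) for the model (5) at positive temperature, finite
volume, dual form, direction-resolved multipliers.** On the even torus of side `L = 2k ≥ 4`, every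
`d`, every spin `S = n/2`, every `K > 0`, every `β > 0`, every real `t`, `μ : Fin d → ℝ` and every
`s ≥ 0` with `-εᵢ(β) ≤ s` for all `i`:
`t·S(S+1)/3 + Σᵢ μᵢ εᵢ(β) - (s/2)^{1/2} 𝓦^K_{t,μ}(L) - (2β)⁻¹ 𝓣^K_{t,μ}(L) ≤ (t - Σᵢ μᵢ)·|Λ|⁻¹ĝ_Q(β)`.
Proof: `t`×(2) `+ Σᵢμᵢ`×(3ᵢ) reads `|Λ|[t S(S+1)/3 + Σᵢμᵢεᵢ] = κ(Q) ĝ_Q + Σ_{q≠Q} κ(q) ĝ_q`, and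
every `q ≠ Q` term is at most `{κ(q)}₊ [(s/2)^{1/2}(E^K_q/E^K_{q-Q})^{1/2} + 1/(2βE^K_{q-Q})]` by the
thermal infrared bound — the ground-state inequality `heisAniso_twoSumRule` plus the
Dyson–Lieb–Simon term, i.e. the combination announced on [KLS1988JSP] p. 1020.
[cite: KLS1988JSP, p. 1020, eqs. (2), (3), (6)-(9)] [cite: DLS1978, Thms. 5.1, 6.1] -/
theorem heisAniso_twoSumRule_thermal (n k : ℕ) [NeZero (2 * k)] (hk : 2 ≤ k) {K : Fin d → ℝ}
    (hK : ∀ i, 0 < K i) {β : ℝ} (hβ : 0 < β) (t : ℝ) (μ : Fin d → ℝ) {s : ℝ} (hs0 : 0 ≤ s)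
    (hs : ∀ i, -gibbsDirBondCorr β (heisAnisoTorus (2 * k) n K) 0 i ≤ s) :
    t * ((n : ℝ) / 2 * ((n : ℝ) / 2 + 1) / 3) +
          ∑ i, μ i * gibbsDirBondCorr β (heisAnisoTorus (2 * k) n K) 0 i -
        Real.sqrt (s / 2) * heisAnisoKlsRiemannSum K t μ (2 * k) -
        1 / (2 * β) * heisAnisoThermalRiemannSum K t μ (2 * k) ≤
      (t - ∑ i, μ i) *
        (gibbsStructureFactor β (heisAnisoTorus (2 * k) n K) 0 (neelIndex (2 * k)) /
          ((2 * k : ℕ) : ℝ) ^ d) := by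
  have h2k : (0 : ℝ) < ((2 * k : ℕ) : ℝ) := by exact_mod_cast (show 0 < 2 * k by omega)
  have hL : (0 : ℝ) < ((2 * k : ℕ) : ℝ) ^ d := pow_pos h2k d
  set Q : TorusSite d (2 * k) := neelIndex (2 * k) with hQ
  set c := (n : ℝ) / 2 * ((n : ℝ) / 2 + 1) / 3 with hc
  set g : TorusSite d (2 * k) → ℝ := fun q => gibbsStructureFactor β (heisAnisoTorus (2 * k) n K) 0 q
    with hg
  set ε : Fin d → ℝ := fun i => gibbsDirBondCorr β (heisAnisoTorus (2 * k) n K) 0 i with hε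
  -- (2): `|Λ| c = ĝ_Q + Σ_{q ≠ Q} ĝ_q`
  have hT : ((2 * k : ℕ) : ℝ) ^ d * c =
      g Q + ∑ q ∈ (univ : Finset (TorusSite d (2 * k))).erase Q, g q := by
    rw [hc, ← heisAniso_gibbsStructureFactor_totalSumRule (2 * k) n K β,
      ← add_sum_erase _ _ (mem_univ Q)]
  -- (3ᵢ): `|Λ| εᵢ = -ĝ_Q + Σ_{q ≠ Q} ĝ_q cos qᵢ`
  have hE : ∀ i, ((2 * k : ℕ) : ℝ) ^ d * ε i =
      -g Q + ∑ q ∈ (univ : Finset (TorusSite d (2 * k))).erase Q,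
        g q * Real.cos (latticeMomentum (2 * k) q i) := by
    intro i
    rw [hε]
    dsimp only
    rw [← heisAniso_gibbsStructureFactor_dirSumRule (2 * k) n K β i,
      ← add_sum_erase _ _ (mem_univ Q), hQ, latticeMomentum_neelIndex k i, Real.cos_pi]
    ring
  -- the combination `t·(2) + Σᵢ μᵢ·(3ᵢ)`
  have hK' : ∑ q ∈ (univ : Finset (TorusSite d (2 * k))).erase Q, g q * heisAnisoKernel t μ (2 * k) q =
      t * ∑ q ∈ (univ : Finset (TorusSite d (2 * k))).erase Q, g q +
        ∑ i, μ i * ∑ q ∈ (univ : Finset (TorusSite d (2 * k))).erase Q,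
          g q * Real.cos (latticeMomentum (2 * k) q i) := by
    have hq : ∀ q : TorusSite d (2 * k), g q * heisAnisoKernel t μ (2 * k) q =
        t * g q + ∑ i, μ i * (g q * Real.cos (latticeMomentum (2 * k) q i)) := by
      intro q
      rw [heisAnisoKernel, mul_add, mul_sum]
      exact congrArg₂ (· + ·) (mul_comm _ _) (sum_congr rfl fun i _ => by ring)
    rw [sum_congr rfl fun q _ => hq q, sum_add_distrib, ← mul_sum, sum_comm]
    simp_rw [mul_sum]
  have hcomb : (t - ∑ i, μ i) * g Q =
      ((2 * k : ℕ) : ℝ) ^ d * (t * c + ∑ i, μ i * ε i) -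
        ∑ q ∈ (univ : Finset (TorusSite d (2 * k))).erase Q, g q * heisAnisoKernel t μ (2 * k) q := by
    rw [hK', mul_add, mul_sum]
    have hEi : ∀ i, μ i * (((2 * k : ℕ) : ℝ) ^ d * ε i) = μ i * (-g Q) +
        μ i * ∑ q ∈ (univ : Finset (TorusSite d (2 * k))).erase Q,
          g q * Real.cos (latticeMomentum (2 * k) q i) := fun i => by rw [hE i, mul_add]
    have hsumE : ∑ i, ((2 * k : ℕ) : ℝ) ^ d * (μ i * ε i) =
        (∑ i, μ i) * (-g Q) + ∑ i, μ i * ∑ q ∈ (univ : Finset (TorusSite d (2 * k))).erase Q,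
          g q * Real.cos (latticeMomentum (2 * k) q i) := by
      rw [sum_mul, ← sum_add_distrib]
      exact sum_congr rfl fun i _ => by rw [← hEi i]; ring
    rw [hsumE]
    linear_combination (-t) * hT
  -- termwise thermal infrared bound on the punctured sum
  have hterm : ∀ q ∈ (univ : Finset (TorusSite d (2 * k))).erase Q,
      g q * heisAnisoKernel t μ (2 * k) q ≤
        Real.sqrt (s / 2) * (max (heisAnisoKernel t μ (2 * k) q) 0 *
          Real.sqrt (NVectorAniso.anisoDispersion K (latticeMomentum (2 * k) q) /
            NVectorAniso.anisoDispersion K (latticeMomentum (2 * k) (q - Q)))) +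
        1 / (2 * β) * (max (heisAnisoKernel t μ (2 * k) q) 0 /
          NVectorAniso.anisoDispersion K (latticeMomentum (2 * k) (q - Q))) := by
    intro q hq
    have hqQ : q ≠ Q := (mem_erase.1 hq).1
    obtain ⟨hgq, hAq⟩ := heisAniso_infraredBound_thermal_of_le n k hk hK hβ hs0 hs q hqQ
    have hE' : 0 < NVectorAniso.anisoDispersion K (latticeMomentum (2 * k) (q - Q)) :=
      anisoDispersion_latticeMomentum_pos (2 * k) hK (sub_ne_zero.2 hqQ)
    have hpt := heisAniso_thermal_pointwise (κ := heisAnisoKernel t μ (2 * k) q) hgq hAq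
    have hre : 1 / (2 * β * NVectorAniso.anisoDispersion K (latticeMomentum (2 * k) (q - Q))) *
        max (heisAnisoKernel t μ (2 * k) q) 0 =
        1 / (2 * β) * (max (heisAnisoKernel t μ (2 * k) q) 0 /
          NVectorAniso.anisoDispersion K (latticeMomentum (2 * k) (q - Q))) := by
      field_simp
    rw [hg]
    linarith [hpt, hre.le, hre.ge]
  have hsum := sum_le_sum hterm
  rw [sum_add_distrib, ← mul_sum, ← mul_sum] at hsum
  rw [heisAnisoKlsRiemannSum_of_neZero, heisAnisoThermalRiemannSum_of_neZero, ← hQ]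
  -- divide the combination by `|Λ|`
  have hgQ : g Q = gibbsStructureFactor β (heisAnisoTorus (2 * k) n K) 0 Q := rfl
  rw [← hgQ]
  have hkey : ((2 * k : ℕ) : ℝ) ^ d * (t * c + ∑ i, μ i * ε i) -
      Real.sqrt (s / 2) * ∑ q ∈ (univ : Finset (TorusSite d (2 * k))).erase Q,
        max (heisAnisoKernel t μ (2 * k) q) 0 *
          Real.sqrt (NVectorAniso.anisoDispersion K (latticeMomentum (2 * k) q) /
            NVectorAniso.anisoDispersion K (latticeMomentum (2 * k) (q - Q))) -
      1 / (2 * β) * ∑ q ∈ (univ : Finset (TorusSite d (2 * k))).erase Q,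
        max (heisAnisoKernel t μ (2 * k) q) 0 /
          NVectorAniso.anisoDispersion K (latticeMomentum (2 * k) (q - Q)) ≤
      (t - ∑ i, μ i) * g Q := by
    rw [hcomb]
    linarith [hsum]
  have hdiv := div_le_div_of_nonneg_right hkey hL.le
  rw [mul_div_assoc] at hdiv
  refine le_trans (le_of_eq ?_) hdiv
  have hL0 : ((2 * k : ℕ) : ℝ) ^ d ≠ 0 := hL.ne'
  field_simp
  ring

/-- **The two-sum-rule bound at positive temperature with the unconditional a-priori bound
`s = S²`** ((T): `-εᵢ(β) ≤ S²`, `abs_gibbsDirBondCorr_le`): for every `t`, `μ`,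
`t·S(S+1)/3 + Σᵢ μᵢ εᵢ(β) - (S²/2)^{1/2} 𝓦^K_{t,μ}(L) - (2β)⁻¹ 𝓣^K_{t,μ}(L) ≤ (t - Σᵢμᵢ)·|Λ|⁻¹ĝ_Q(β)`
— Dyson–Lieb–Simon's original (large-spin) use of the infrared bound, for direction-dependent
couplings. [cite: DLS1978, Thm. 6.2] [cite: KLS1988JSP, p. 1020, eqs. (6)-(9)] -/
theorem heisAniso_twoSumRule_thermal_sq (n k : ℕ) [NeZero (2 * k)] (hk : 2 ≤ k) {K : Fin d → ℝ}
    (hK : ∀ i, 0 < K i) {β : ℝ} (hβ : 0 < β) (t : ℝ) (μ : Fin d → ℝ) :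
    t * ((n : ℝ) / 2 * ((n : ℝ) / 2 + 1) / 3) +
          ∑ i, μ i * gibbsDirBondCorr β (heisAnisoTorus (2 * k) n K) 0 i -
        Real.sqrt (((n : ℝ) / 2) ^ 2 / 2) * heisAnisoKlsRiemannSum K t μ (2 * k) -
        1 / (2 * β) * heisAnisoThermalRiemannSum K t μ (2 * k) ≤
      (t - ∑ i, μ i) *
        (gibbsStructureFactor β (heisAnisoTorus (2 * k) n K) 0 (neelIndex (2 * k)) /
          ((2 * k : ℕ) : ℝ) ^ d) :=
  heisAniso_twoSumRule_thermal n k hk hK hβ t μ (sq_nonneg _) fun i => by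
    have h := abs_gibbsDirBondCorr_le β (heisAnisoTorus_isHermitian (2 * k) n K) 0 i
    rw [abs_le] at h
    linarith [h.1]

/-! ### The staggered order parameter at positive temperature and Néel order from a certificate -/

section NeelOrder

/-- **The Néel order parameter of `H_K` at inverse temperature `β`.** On the even torus of side
`2k`, the staggered, volume-normalised double sum of `Σ_α G^α_β(x,y) = ⟨𝐒_x·𝐒_y⟩_β` is
`3 |Λ|⁻¹ ĝ_Q(β)` (isotropy (Iᵀ) and `cos(Q·(x-y)) = (-1)^x(-1)^y`).
[cite: KLS1988JSP, p. 1021] [cite: DLS1978, §1 eq. (4)] -/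
theorem heisAniso_thermal_neelSum_eq (n k : ℕ) [NeZero (2 * k)] (K : Fin d → ℝ) (β : ℝ) :
    (∑ x : TorusSite d (2 * k), ∑ y : TorusSite d (2 * k),
        (-1 : ℝ) ^ (∑ i, (x i).val) * (-1) ^ (∑ i, (y i).val) *
          ∑ α : Fin 3, gibbsSpinCorr β (heisAnisoTorus (2 * k) n K) α x y) /
        ((2 * k : ℕ) : ℝ) ^ (2 * d) =
      3 * (gibbsStructureFactor β (heisAnisoTorus (2 * k) n K) 0 (neelIndex (2 * k)) /
        ((2 * k : ℕ) : ℝ) ^ d) := by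
  have h2k : ((2 * k : ℕ) : ℝ) ≠ 0 := by exact_mod_cast NeZero.ne (2 * k)
  have hL : ((2 * k : ℕ) : ℝ) ^ d ≠ 0 := pow_ne_zero _ h2k
  rw [gibbsStructureFactor, div_div, ← pow_add, show d + d = 2 * d by ring, mul_div_assoc', mul_sum]
  refine congrArg (· / ((2 * k : ℕ) : ℝ) ^ (2 * d)) ?_
  refine sum_congr rfl fun x _ => ?_
  rw [mul_sum]
  refine sum_congr rfl fun y _ => ?_
  rw [cos_torusPhase_neelIndex_sub k, Fin.sum_univ_three,
    gibbsSpinCorr_anisoHeis_eq_zero_comp (2 * k) n K β 1,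
    gibbsSpinCorr_anisoHeis_eq_zero_comp (2 * k) n K β 2]
  ring

/-- The thermal order-parameter sequence is bounded: `|L^{-2d} Σ_{x,y} ± Σ_α G^α_β| ≤ 3S²` (from (T)).
[cite: KLS1988JSP, p. 1021] -/
theorem heisAniso_thermal_neelSum_le (n L : ℕ) [NeZero L] (K : Fin d → ℝ) (β : ℝ) :
    (∑ x : TorusSite d L, ∑ y : TorusSite d L,
        (-1 : ℝ) ^ (∑ i, (x i).val) * (-1) ^ (∑ i, (y i).val) *
          ∑ α : Fin 3, gibbsSpinCorr β (heisAnisoTorus L n K) α x y) / (L : ℝ) ^ (2 * d) ≤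
      3 * ((n : ℝ) / 2) ^ 2 := by
  have hH := heisAnisoTorus_isHermitian L n K
  have hL0 : (0 : ℝ) < L := by exact_mod_cast Nat.pos_of_ne_zero (NeZero.ne L)
  have hLpos : (0 : ℝ) < (L : ℝ) ^ (2 * d) := by positivity
  rw [div_le_iff₀ hLpos]
  have hb : ∀ x y : TorusSite d L, (-1 : ℝ) ^ (∑ i, (x i).val) * (-1) ^ (∑ i, (y i).val) *
      ∑ α : Fin 3, gibbsSpinCorr β (heisAnisoTorus L n K) α x y ≤ 3 * ((n : ℝ) / 2) ^ 2 := by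
    intro x y
    have h3 : |∑ α : Fin 3, gibbsSpinCorr β (heisAnisoTorus L n K) α x y| ≤ 3 * ((n : ℝ) / 2) ^ 2 := by
      calc |∑ α : Fin 3, gibbsSpinCorr β (heisAnisoTorus L n K) α x y|
          ≤ ∑ α : Fin 3, |gibbsSpinCorr β (heisAnisoTorus L n K) α x y| := abs_sum_le_sum_abs _ _
        _ ≤ ∑ _α : Fin 3, ((n : ℝ) / 2) ^ 2 :=
            sum_le_sum fun α _ => abs_gibbsSpinCorr_le β hH α x y
        _ = 3 * ((n : ℝ) / 2) ^ 2 := by simp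
    have hs : |(-1 : ℝ) ^ (∑ i, (x i).val) * (-1) ^ (∑ i, (y i).val)| = 1 := by
      rw [abs_mul, abs_neg_one_pow, abs_neg_one_pow, mul_one]
    have := abs_mul ((-1 : ℝ) ^ (∑ i, (x i).val) * (-1) ^ (∑ i, (y i).val))
      (∑ α : Fin 3, gibbsSpinCorr β (heisAnisoTorus L n K) α x y)
    rw [hs, one_mul] at this
    exact (le_abs_self _).trans (this ▸ h3)
  calc ∑ x : TorusSite d L, ∑ y : TorusSite d L, (-1 : ℝ) ^ (∑ i, (x i).val) *
        (-1) ^ (∑ i, (y i).val) * ∑ α : Fin 3, gibbsSpinCorr β (heisAnisoTorus L n K) α x y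
      ≤ ∑ _x : TorusSite d L, ∑ _y : TorusSite d L, 3 * ((n : ℝ) / 2) ^ 2 :=
        sum_le_sum fun x _ => sum_le_sum fun y _ => hb x y
    _ = 3 * ((n : ℝ) / 2) ^ 2 * (L : ℝ) ^ (2 * d) := by
        rw [sum_const, sum_const, card_univ, nsmul_eq_mul, nsmul_eq_mul, Fintype.card_pi, prod_const,
          ZMod.card, card_univ, Fintype.card_fin]
        push_cast
        ring

/-- **Néel order of the model (5) at a fixed inverse temperature `β` from a certificate** (the form
in which certified values of the two integrals are consumed). Data: `K > 0`, spin `S = n/2`,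
`β > 0`, finitely many quadruples `(tⱼ, μⱼ, W̄ⱼ, T̄ⱼ)` with `tⱼ - Σᵢμⱼᵢ > 0` and, along the even
sides, eventually `𝓦^K_{tⱼ,μⱼ}(2k) ≤ W̄ⱼ` and `𝓣^K_{tⱼ,μⱼ}(2k) ≤ T̄ⱼ`; and a margin `δ` such that every
vector `ε` of the a-priori region — (T) `|εᵢ| ≤ S²` and (Nᵀ)
`ΣᵢKᵢεᵢ ≤ -(S²/3)ΣᵢKᵢ + log(n+1)/(3β)` — admits `j` with
`δ(tⱼ - Σᵢμⱼᵢ) ≤ tⱼS(S+1)/3 + Σᵢμⱼᵢεᵢ - (S²/2)^{1/2}W̄ⱼ - T̄ⱼ/(2β)`. Then eventually (along the sides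
`2k + 2`) `|Λ|⁻¹ĝ_Q(β) ≥ δ`. ([KLS1988JSP] p. 1023 "there must be Néel order", at `T > 0` as announced
on p. 1020; [DLS1978] Thm. 6.2.) [cite: KLS1988JSP, p. 1020, eqs. (5)-(9), p. 1023] [cite: DLS1978, Thm. 6.2] -/
theorem heisAniso_thermal_neelOrder_of_certificate {n : ℕ} {K : Fin d → ℝ} (hK : ∀ i, 0 < K i)
    {β : ℝ} (hβ : 0 < β) {ι : Type*} (J : Finset ι) (t : ι → ℝ) (μ : ι → Fin d → ℝ)
    (Wbar Tbar : ι → ℝ) (hpos : ∀ j ∈ J, 0 < t j - ∑ i, μ j i)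
    (hW : ∀ j ∈ J, ∀ᶠ k : ℕ in atTop, heisAnisoKlsRiemannSum K (t j) (μ j) (2 * k) ≤ Wbar j)
    (hT : ∀ j ∈ J, ∀ᶠ k : ℕ in atTop, heisAnisoThermalRiemannSum K (t j) (μ j) (2 * k) ≤ Tbar j)
    {δ : ℝ}
    (hcert : ∀ ε : Fin d → ℝ, (∀ i, |ε i| ≤ ((n : ℝ) / 2) ^ 2) →
      (∑ i, K i * ε i ≤ -(((n : ℝ) / 2) ^ 2 / 3) * ∑ i, K i + Real.log (n + 1) / (3 * β)) →
      ∃ j ∈ J, δ * (t j - ∑ i, μ j i) ≤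
        t j * ((n : ℝ) / 2 * ((n : ℝ) / 2 + 1) / 3) + ∑ i, μ j i * ε i -
          Real.sqrt (((n : ℝ) / 2) ^ 2 / 2) * Wbar j - 1 / (2 * β) * Tbar j) :
    ∀ᶠ k : ℕ in atTop,
      δ ≤ gibbsStructureFactor β (heisAnisoTorus (2 * k + 2) n K) 0 (neelIndex (2 * k + 2)) /
        ((2 * k + 2 : ℕ) : ℝ) ^ d := by
  have hall : ∀ᶠ k : ℕ in atTop, ∀ j ∈ J,
      heisAnisoKlsRiemannSum K (t j) (μ j) (2 * k) ≤ Wbar j ∧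
        heisAnisoThermalRiemannSum K (t j) (μ j) (2 * k) ≤ Tbar j :=
    (J.eventually_all).2 fun j hj => (hW j hj).and (hT j hj)
  have h2k : Tendsto (fun k : ℕ => k + 1) atTop atTop :=
    tendsto_atTop_atTop.2 fun b => ⟨b, fun k hk => by omega⟩
  filter_upwards [h2k.eventually hall, eventually_ge_atTop 1] with k hk hk1
  haveI : NeZero (2 * (k + 1)) := ⟨by omega⟩
  have hk2 : 2 ≤ k + 1 := by omega
  have hL3 : 3 ≤ 2 * (k + 1) := by omega
  show δ ≤ gibbsStructureFactor β (heisAnisoTorus (2 * (k + 1)) n K) 0 (neelIndex (2 * (k + 1))) /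
      ((2 * (k + 1) : ℕ) : ℝ) ^ d
  set ε : Fin d → ℝ := fun i => gibbsDirBondCorr β (heisAnisoTorus (2 * (k + 1)) n K) 0 i with hε
  have hTb : ∀ i, |ε i| ≤ ((n : ℝ) / 2) ^ 2 := fun i =>
    abs_gibbsDirBondCorr_le β (heisAnisoTorus_isHermitian (2 * (k + 1)) n K) 0 i
  have hN : ∑ i, K i * ε i ≤ -(((n : ℝ) / 2) ^ 2 / 3) * ∑ i, K i + Real.log (n + 1) / (3 * β) :=
    heisAniso_thermal_neelBound (k + 1) n hL3 K hβ
  obtain ⟨j, hj, hcj⟩ := hcert ε hTb hN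
  have hmain := heisAniso_twoSumRule_thermal_sq n (k + 1) hk2 hK hβ (t j) (μ j)
  obtain ⟨hWk, hTk⟩ := hk j hj
  have hsq : 0 ≤ Real.sqrt (((n : ℝ) / 2) ^ 2 / 2) := Real.sqrt_nonneg _
  have hβ' : 0 ≤ 1 / (2 * β) := by positivity
  have h1 : t j * ((n : ℝ) / 2 * ((n : ℝ) / 2 + 1) / 3) + ∑ i, μ j i * ε i -
        Real.sqrt (((n : ℝ) / 2) ^ 2 / 2) * Wbar j - 1 / (2 * β) * Tbar j ≤
      t j * ((n : ℝ) / 2 * ((n : ℝ) / 2 + 1) / 3) + ∑ i, μ j i * ε i -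
        Real.sqrt (((n : ℝ) / 2) ^ 2 / 2) * heisAnisoKlsRiemannSum K (t j) (μ j) (2 * (k + 1)) -
        1 / (2 * β) * heisAnisoThermalRiemannSum K (t j) (μ j) (2 * (k + 1)) := by
    nlinarith [mul_le_mul_of_nonneg_left hWk hsq, mul_le_mul_of_nonneg_left hTk hβ']
  have h2 := (hcj.trans h1).trans hmain
  exact le_of_mul_le_mul_left (by linarith [h2]) (hpos j hj)

/-- **Néel long-range order at inverse temperature `β` from a certificate**, as a `liminf`: under the
hypotheses of `heisAniso_thermal_neelOrder_of_certificate`,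
`liminf_k |Λ_k|⁻² Σ_{x,y} (-1)^{x+y} Σ_α G^α_β(x,y) ≥ 3δ` along the even tori `(ℤ/(2k+2)ℤ)^d` —
positive as soon as the certificate margin `δ` is; the positive-temperature phase transition of the
model (5) announced on [KLS1988JSP] p. 1020, in certificate form.
[cite: KLS1988JSP, p. 1020, p. 1023] [cite: DLS1978, Thm. 6.2] -/
theorem heisAniso_thermal_neelLRO_of_certificate {n : ℕ} {K : Fin d → ℝ} (hK : ∀ i, 0 < K i)
    {β : ℝ} (hβ : 0 < β) {ι : Type*} (J : Finset ι) (t : ι → ℝ) (μ : ι → Fin d → ℝ)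
    (Wbar Tbar : ι → ℝ) (hpos : ∀ j ∈ J, 0 < t j - ∑ i, μ j i)
    (hW : ∀ j ∈ J, ∀ᶠ k : ℕ in atTop, heisAnisoKlsRiemannSum K (t j) (μ j) (2 * k) ≤ Wbar j)
    (hT : ∀ j ∈ J, ∀ᶠ k : ℕ in atTop, heisAnisoThermalRiemannSum K (t j) (μ j) (2 * k) ≤ Tbar j)
    {δ : ℝ}
    (hcert : ∀ ε : Fin d → ℝ, (∀ i, |ε i| ≤ ((n : ℝ) / 2) ^ 2) →
      (∑ i, K i * ε i ≤ -(((n : ℝ) / 2) ^ 2 / 3) * ∑ i, K i + Real.log (n + 1) / (3 * β)) →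
      ∃ j ∈ J, δ * (t j - ∑ i, μ j i) ≤
        t j * ((n : ℝ) / 2 * ((n : ℝ) / 2 + 1) / 3) + ∑ i, μ j i * ε i -
          Real.sqrt (((n : ℝ) / 2) ^ 2 / 2) * Wbar j - 1 / (2 * β) * Tbar j) :
    3 * δ ≤ liminf (fun k : ℕ =>
      (∑ x : TorusSite d (2 * k + 2), ∑ y : TorusSite d (2 * k + 2),
        (-1 : ℝ) ^ (∑ i, (x i).val) * (-1) ^ (∑ i, (y i).val) *
          ∑ α : Fin 3, gibbsSpinCorr β (heisAnisoTorus (2 * k + 2) n K) α x y) /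
        ((2 * k + 2 : ℕ) : ℝ) ^ (2 * d)) atTop := by
  have hev := heisAniso_thermal_neelOrder_of_certificate hK hβ J t μ Wbar Tbar hpos hW hT hcert
  refine le_liminf_of_le ?_ ?_
  · exact isCoboundedUnder_ge_of_le atTop fun k => by
      haveI : NeZero (2 * k + 2) := ⟨by omega⟩
      exact heisAniso_thermal_neelSum_le n (2 * k + 2) K β
  · filter_upwards [hev] with k hk
    haveI : NeZero (2 * (k + 1)) := ⟨by omega⟩
    show 3 * δ ≤ (∑ x : TorusSite d (2 * (k + 1)), ∑ y : TorusSite d (2 * (k + 1)),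
        (-1 : ℝ) ^ (∑ i, (x i).val) * (-1) ^ (∑ i, (y i).val) *
          ∑ α : Fin 3, gibbsSpinCorr β (heisAnisoTorus (2 * (k + 1)) n K) α x y) /
        ((2 * (k + 1) : ℕ) : ℝ) ^ (2 * d)
    rw [heisAniso_thermal_neelSum_eq n (k + 1) K β]
    have hk' : δ ≤ gibbsStructureFactor β (heisAnisoTorus (2 * (k + 1)) n K) 0
        (neelIndex (2 * (k + 1))) / ((2 * (k + 1) : ℕ) : ℝ) ^ d := hk
    linarith

end NeelOrder

end Literature.MathematicalPhysics.QuantumLattice
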